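import Mathlib.Tactic
import HarnessLib

/-!
# Kozma–Nitzan's Question 8 — UNI-C(U;y): structural kernels for the A-death regime (gen 40)

Support file (`--supports stmt-CriticalPhenomena-4575`, closed crux; independent mathematics on Kozma–Nitzan's Question 8,
arXiv:2401.12397 §5.5 p. 36), prover `prim-ineq-gen-6` (gen 40).  No definitions, no named facts, no sorries; standard axioms.
Memo `run/shared/lean/prim/prim-ineq-gen-6/FINDING-G40.md` §3 (the A-death regime `fa_{v−1} > 1` of the per-vertex family).

In the A-death regime every member of the per-vertex family carries the factor `Λ = fa/DEN_t ≤ 1/(γ_t + (1−γ_t)/fa)`, so a lower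
bound of the C-survival `γ_t = γ_i·C_[k₁,t]` is needed.  The algebraic cores landed here:
* `kAD_jd_term` — the termwise step of the JOINT-DEATH bound `JD_t := Σ_b ρ̂_b S_[b+1,t](1−A_[b,t])(1−C_[b,t]) ≤ 1 − Φ(T_{k₁})`
  (a corollary of the renewal identity of gen 38: `Ĵ_b ≥ S_[b+1,t](1−A_[b,t])(1−C_[b,t])`);
* `kAD_closs` — its base-`k₁` consequence with `Φ(T_{k₁})(1+λ) > 1`:  `C_[k₁,t] > 1 − λ/((1+λ)σ_tα_t)`  (the C-LOSS bound: at a node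
  connected to the positive region and behind an A-death, the C-loss is `< λ/(1+λ)`);
* `kAD_rho_step` — the summand of the induction `ρ̂_b ≥ (1−s_b)·C_[k₁,b−1]` (renewal weight versus C-survival), which removes the
  factor `Φ(T_{k₁})` from PROPOSITION D3′: `Ω_w ≥ C_[k₁,w−1]·M_w`;
* `kAD_ushadow_ratio` — `[α + (1−α)s·ǔ]·S̄ ≤ α·S̄ + (1−α·S̄)·ǔ` for `s ≤ S̄`: with the tail bound `ǔ_{u*} ≤ α_{v−1} + (1−α_{v−1})S_[u*+1,v]ǔ_v`
  it gives `ǔ_{u*}/M_v ≤ 1/S̄^A_v` (the u*-shadow form of the joint member);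
* `kAD_flat` — `Λ = fa/DEN_t ≤ 1/(γ_t + (1−γ_t)/fa)` and its monotonicity in `γ_t`;
* `kAD_assembly` — the division step `POST₂γ_iΛ/σ_v ≤ POST₂/(σ_v·D)` once `γ_iΛ ≤ 1/D`.
Exact link checks: lab-g40/g40/l06_adeath2.py, l07_jd.py (0 failures).
[cite: KozmaNitzan2024, Question 8 (§5.5 p. 36)]
-/

namespace Summit.CriticalPhenomena.PercolationContinuityZ3.Theorems

namespace PocketCert

/-- **Joint death, termwise.**  Along a fragment the survivals only decrease: for `k ≥ t`, `A_[b,k] ≤ A_[b,t]` and `C_[b,k] ≤ C_[b,t]`,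
hence `(1−A_[b,k])(1−C_[b,k]) ≥ (1−A_[b,t])(1−C_[b,t])`; summing with the run weights gives `Ĵ_b ≥ S_[b+1,t](1−A_[b,t])(1−C_[b,t])`
and, with the renewal identity `1 − Φ(T_{k₁}) = Σ_b ρ̂_b Ĵ_b`, the joint-death bound `JD_t ≤ 1 − Φ(T_{k₁})`.
[cite: KozmaNitzan2024, Question 8 (§5.5 p. 36)] -/
theorem kAD_jd_term (A A' C C' : ℝ) (hA : A ≤ A') (hA' : A' ≤ 1) (hC : C ≤ C') (hC' : C' ≤ 1) :
    (1 - A') * (1 - C') ≤ (1 - A) * (1 - C) := by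
  have h1 : 0 ≤ 1 - A' := by linarith
  have h2 : 0 ≤ 1 - C' := by linarith
  calc (1 - A') * (1 - C') ≤ (1 - A) * (1 - C') := mul_le_mul_of_nonneg_right (by linarith) h2
    _ ≤ (1 - A) * (1 - C) := mul_le_mul_of_nonneg_left (by linarith) (le_trans h1 (by linarith))

/-- **The C-LOSS bound behind an A-death.**  The base-`k₁` term of the joint-death bound is `σ_t·α_t·(1 − C_[k₁,t]) ≤ JD_t ≤ 1 − Φ_K`,
and `Φ_K(1+λ) > 1` ((S1), gen 39).  Hence `C_[k₁,t] > 1 − λ/((1+λ)·σ_tα_t)`: a node connected to the positive region (`σ_t`) and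
lying behind an A-death (`α_t = 1 − A_[k₁,t]`) has lost less than the fraction `λ/((1+λ)σ_tα_t)` of its C-mass since `k₁`.
[cite: KozmaNitzan2024, Question 8 (§5.5 p. 36)] -/
theorem kAD_closs (σ α C J Φ lam : ℝ) (hσα : 0 < σ * α) (hlam : 0 ≤ lam)
    (hJ : σ * α * (1 - C) ≤ J) (hJΦ : J ≤ 1 - Φ) (hΦ : 1 < Φ * (1 + lam)) :
    1 - lam / ((1 + lam) * (σ * α)) < C := by
  have h1 : 0 < 1 + lam := by linarith
  have hpos : 0 < (1 + lam) * (σ * α) := mul_pos h1 hσα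
  -- (1 − C)·σα ≤ 1 − Φ < λ/(1+λ)
  have h2 : 1 - Φ < lam / (1 + lam) := by
    rw [lt_div_iff₀ h1]; nlinarith
  have h3 : σ * α * (1 - C) < lam / (1 + lam) := lt_of_le_of_lt (le_trans hJ hJΦ) h2
  have h4 : lam / ((1 + lam) * (σ * α)) = lam / (1 + lam) / (σ * α) := by
    rw [div_div]
  rw [h4, sub_lt_comm, lt_div_iff₀ hσα]
  linarith

/-- **Renewal weight versus C-survival (induction summand).**  In `ρ̂_b = Σ_{b'<b} ρ̂_{b'}·run(b',b−1)·M(A_[b',b−1],C_[b',b−1])`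
each summand is at least `(1−s_{b'})C_[k₁,b'−1]·run(b',b−1)·C_[b',b−1]` (use `M ≥ C` and the induction hypothesis), and
`Σ_{b'<b}(1−s_{b'})run(b',b−1) = 1 − s_b`; so `ρ̂_b ≥ (1−s_b)C_[k₁,b−1]` and PROPOSITION D3′ holds without the factor `Φ(T_{k₁})`:
`Ω_w ≥ C_[k₁,w−1]·M_w`.
[cite: KozmaNitzan2024, Question 8 (§5.5 p. 36)] -/
theorem kAD_rho_step (ρ r C₁ run M C₂ : ℝ) (hr : 0 ≤ r) (hC₁ : 0 ≤ C₁) (hrun : 0 ≤ run) (hC₂ : 0 ≤ C₂)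
    (hρ : r * C₁ ≤ ρ) (hM : C₂ ≤ M) :
    (r * run) * (C₁ * C₂) ≤ ρ * run * M := by
  have h1 : 0 ≤ r * C₁ := mul_nonneg hr hC₁
  have h2 : r * C₁ * run ≤ ρ * run := mul_le_mul_of_nonneg_right hρ hrun
  have h3 : 0 ≤ ρ * run := le_trans (mul_nonneg h1 hrun) h2
  calc (r * run) * (C₁ * C₂) = (r * C₁ * run) * C₂ := by ring
    _ ≤ (ρ * run) * C₂ := mul_le_mul_of_nonneg_right h2 hC₂
    _ ≤ ρ * run * M := mul_le_mul_of_nonneg_left hM h3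

/-- **u*-shadow ratio.**  For `0 ≤ s ≤ S̄ ≤ 1`, `α ≤ 1`, `ǔ ≥ 0`:  `[α + (1−α)·s·ǔ]·S̄ ≤ α·S̄ + (1 − α·S̄)·ǔ`.  With
`ǔ_{u*} ≤ α_{v−1} + (1−α_{v−1})S_[u*+1,v]ǔ_v` and `S_[u*+1,v] ≤ S̄^A_v` this is `ǔ_{u*}·S̄^A_v ≤ M_v`.
[cite: KozmaNitzan2024, Question 8 (§5.5 p. 36)] -/
theorem kAD_ushadow_ratio (α s Sb u : ℝ) (hα1 : α ≤ 1) (hs0 : 0 ≤ s) (hs : s ≤ Sb) (hSb : Sb ≤ 1)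
    (hu : 0 ≤ u) : (α + (1 - α) * s * u) * Sb ≤ α * Sb + (1 - α * Sb) * u := by
  have h1 : 0 ≤ 1 - α := by linarith
  have hSb0 : 0 ≤ Sb := le_trans hs0 hs
  -- (1−α)·s·Sb ≤ (1−α)·Sb ≤ 1 − α·Sb
  have h2 : (1 - α) * s * Sb ≤ 1 - α * Sb := by nlinarith [mul_nonneg h1 hSb0, mul_nonneg (mul_nonneg h1 hSb0) (sub_nonneg.mpr (le_trans hs hSb))]
  nlinarith [mul_le_mul_of_nonneg_right h2 hu]

/-- **The flat factor.**  `DEN_t ≥ (1−γ_t) + γ_t·fa` (since `1/a_t − 1 ≥ fa_t ≥ fa`), so `Λ = fa/DEN_t ≤ 1/(γ_t + (1−γ_t)/fa)`,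
and the right-hand side is non-increasing in `γ_t` when `fa ≥ 1`; a lower bound `γ_lb ≤ γ_t` may therefore be substituted.
[cite: KozmaNitzan2024, Question 8 (§5.5 p. 36)] -/
theorem kAD_flat (fa DEN γ γlb : ℝ) (hfa : 1 ≤ fa) (hγ0 : 0 ≤ γ) (hγ1 : γ ≤ 1) (hlb0 : 0 < γlb) (hlb : γlb ≤ γ)
    (hDEN : (1 - γ) + γ * fa ≤ DEN) :
    fa / DEN ≤ 1 / (γlb + (1 - γlb) / fa) := by
  have hfa0 : 0 < fa := by linarith
  have hD0 : 0 < (1 - γ) + γ * fa := by nlinarith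
  have hDEN0 : 0 < DEN := lt_of_lt_of_le hD0 hDEN
  have hden2 : 0 < γlb + (1 - γlb) / fa := by
    have : 0 ≤ (1 - γlb) / fa := div_nonneg (by linarith) hfa0.le
    linarith
  rw [div_le_div_iff₀ hDEN0 hden2, one_mul]
  -- fa·(γlb + (1−γlb)/fa) = fa·γlb + (1 − γlb) ≤ (1−γ) + γ·fa ≤ DEN   (monotone in γ since fa ≥ 1)
  have e : fa * (γlb + (1 - γlb) / fa) = fa * γlb + (1 - γlb) := by
    field_simp
  rw [e]
  nlinarith [mul_le_mul_of_nonneg_left hlb (by linarith : (0:ℝ) ≤ fa - 1)]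

/-- **Assembly of the joint member in the A-death regime.**  If `γ_i·Λ ≤ 1/D` with `D > 0` then
`POST₂·γ_i·Λ/σ_v ≤ POST₂/(σ_v·D)`.
[cite: KozmaNitzan2024, Question 8 (§5.5 p. 36)] -/
theorem kAD_assembly (P γ Λ σ D : ℝ) (hP : 0 ≤ P) (hσ : 0 < σ) (hD : 0 < D) (h : γ * Λ ≤ 1 / D) :
    P * γ * Λ / σ ≤ P / (σ * D) := by
  rw [div_le_div_iff₀ hσ (mul_pos hσ hD)]
  have h1 : P * (γ * Λ) ≤ P * (1 / D) := mul_le_mul_of_nonneg_left h hP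
  have h2 : P * (1 / D) * (σ * D) = P * σ := by field_simp
  calc P * γ * Λ * (σ * D) = P * (γ * Λ) * (σ * D) := by ring
    _ ≤ P * (1 / D) * (σ * D) := mul_le_mul_of_nonneg_right h1 (mul_pos hσ hD).le
    _ = P * σ := h2

end PocketCert

end Summit.CriticalPhenomena.PercolationContinuityZ3.Theorems
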